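import Summits.BirchSwinnertonDyer.BirchSwinnertonDyer.Theorems.KolyvaginRoadThreeSchneiderTamAtThreeHeightLogNumeratorDeepRefined
import HarnessLib

/-!
# Crux `SchneiderTamAtThree` (item 19154) — THE HEIGHT IS THE LOGARITHM OF THE NUMERATOR, DEEP POINTS,
# part 6b: the two corollaries of the order-`q` law — precision `2k + min(2k, ν+1)`, and, for THE Tate
# parameter, the RATIONAL closed form `log₃ a + [κ₀' + 60c₆/(c₄ j)]·D/a` to precision `2k + min(2k, 2ν)`

HONEST FRAMING (cell `bsd-stepL`, seat `bsd-stepL-tam3-p2` g2, WIDTH-LEVER second lane «closed-form Schneider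
local factor at 3 … finite case table proved once»; `--supports stmt-BirchSwinnertonDyer-19154 --as helper`):
THEOREMS ONLY, unconditional, route-independent (no Theses import); 0 definitions, 0 named facts, 0 sorry;
nothing here proves the crux `SchneiderTamAtThree`, Schneider's conjecture or BSD.

* `norm_heightFourOneCoord_sub_padicLog_num_sub_le_deep'` — **`‖ĥ₃(P) − log₃ a − κ₀'·D/a‖₃ ≤
  ‖x‖₃⁻¹·max(‖x‖₃⁻¹, 3⁻¹‖q‖₃)`** (`κ₀' = (b₂b₄ − 18b₆)/c₄`; level `k ≥ 2`): precision `2k + min(2k, ν+1)`,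
  observed (kit j285773) to hold on all 690 rows of lane A's table and to be attained on 505.
* `norm_heightFourOneCoord_sub_padicLog_num_sub_le_deep_j` — for the Tate parameter of `W`
  (`tateJ q = j(W)`, so `‖q − 1/j‖ ≤ ‖q‖²`, tree `norm_inv_tateJ_sub_le`): **`‖ĥ₃(P) − log₃ a −
  [κ₀' + 60(c₆/c₄)/j]·D/a‖₃ ≤ ‖x‖₃⁻¹·max(‖x‖₃⁻¹, ‖q‖₃²)`** — the height is a RATIONAL closed form in the
  minimal model (`1/j = Δ/c₄³`) to precision `3^{2k + min(2k, 2ν)}`, `ν = v₃(Δ)` the Kodaira index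
  (observed ≥ on all 690 rows, seat numerics with job2's script).

References: [SteinWuthrich2013] §4.1–4.2; [SilvermanATAEC1994] V.3, V.5 (`j(q) = 1/q + 744 + …`); tree: deep
part 6, `Literature.…PAdicHeightsProofs` (`norm_inv_tateJ_sub_le`).
-/

noncomputable section

open scoped Classical Nat
open Filter Topology IsUltrametricDist PowerSeries
open WeierstrassCurve Literature.NumberTheory.EllipticCurves
open Literature.NumberTheory.EllipticCurves.SteinWuthrich2013
open Literature.NumberTheory.EllipticCurves.TateCurve
open Literature.NumberTheory.EllipticCurves.Rank1Residual
open Summit.BirchSwinnertonDyer.Uniform.UI.O2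

namespace Summit.BirchSwinnertonDyer.Rank1Residual.X11b.RegMult.HeightLogNumerator

section Laws

variable {W : WeierstrassCurve ℚ}

/-- **THE REFINED DEEP-POINT LAW (precision `2k + min(2k, ν+1)`).** For `W/ℚ` globally minimal with
multiplicative reduction at `3`, any `‖q‖₃ < 1` and any rational affine point `P = (x, y)` of level `≥ 2`:
`‖ĥ₃(P) − log₃(num x) − ((b₂b₄ − 18b₆)/c₄)·(den x)/(num x)‖₃ ≤ ‖x‖₃⁻¹·max(‖x‖₃⁻¹, 3⁻¹‖q‖₃)` — part 6's
order-`q` law with the term `60(c₆/c₄)q·D/a` (norm `≤ 3⁻¹‖q‖‖x‖⁻¹`, `3 ∣ 60`) dropped.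
[cite: SteinWuthrich2013, §4.1 eq. (4.1), §4.2] [cite: SilvermanATAEC1994, Thm. V.3.1 (b)] -/
theorem norm_heightFourOneCoord_sub_padicLog_num_sub_le_deep' [W.IsElliptic] [W.IsGloballyMinimal]
    (hW : Mult W 3) {q : ℚ_[3]} (hq : ‖q‖ < 1) {x y : ℚ} (hxy : W.toAffine.Nonsingular x y)
    (hx : 1 < ‖(x : ℚ_[3])‖) (hz9 : ‖-(x : ℚ_[3]) / y‖ ≤ 1 / 9) :
    ‖heightFourOneCoord W 3 q x y - padicLog 3 ((x.num : ℚ) : ℚ_[3]) -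
        ((W.baseChange ℚ_[3]).b₂ * (W.baseChange ℚ_[3]).b₄ - 18 * (W.baseChange ℚ_[3]).b₆) /
          (W.baseChange ℚ_[3]).c₄ * (((x.den : ℚ) : ℚ_[3]) / ((x.num : ℚ) : ℚ_[3]))‖
      ≤ ‖(x : ℚ_[3])‖⁻¹ * max ‖(x : ℚ_[3])‖⁻¹ (3⁻¹ * ‖q‖) := by
  set X : ℚ_[3] := (x : ℚ_[3]) with hXdef
  set V := W.baseChange ℚ_[3] with hVdef
  set a : ℚ_[3] := ((x.num : ℚ) : ℚ_[3]) with hadef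
  set D : ℚ_[3] := ((x.den : ℚ) : ℚ_[3]) with hDdef
  have hB := norm_heightFourOneCoord_sub_padicLog_num_sub_sub_le_deep hW hq hxy hx hz9
  have hX0n : 0 < ‖X‖ := one_pos.trans hx
  have hnum : a = X * D := by rw [hadef, hXdef, hDdef, ← Rat.cast_mul, Rat.mul_den_eq_num]
  have hDn : ‖D‖ = ‖X‖⁻¹ := by rw [hDdef]; exact norm_den_eq_inv_norm hx
  have han : ‖a‖ = 1 := by rw [hnum, norm_mul, hDn, mul_inv_cancel₀ hX0n.ne']
  have hDa : ‖D / a‖ = ‖X‖⁻¹ := by rw [norm_div, han, div_one, hDn]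
  obtain ⟨hc4, hc6⟩ := norm_c₄_c₆_baseChange_eq_one (W := W) hW
  have h3n : ‖(3 : ℚ_[3])‖ = 1 / 3 := by
    rw [show (3 : ℚ_[3]) = ((3 : ℕ) : ℚ_[3]) by norm_cast, Padic.norm_p]; norm_num
  have h60 : ‖(60 : ℚ_[3])‖ ≤ 3⁻¹ := by
    rw [show (60 : ℚ_[3]) = ((20 : ℤ) : ℚ_[3]) * 3 by norm_num, norm_mul, h3n]
    calc ‖((20 : ℤ) : ℚ_[3])‖ * (1 / 3) ≤ 1 * (1 / 3) := by gcongr; exact Padic.norm_int_le_one 20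
      _ = 3⁻¹ := by norm_num
  have hT : ‖60 * (V.c₆ / V.c₄) * q * (D / a)‖ ≤ ‖X‖⁻¹ * (3⁻¹ * ‖q‖) := by
    rw [norm_mul, norm_mul, norm_mul, norm_div, hc6, hc4, div_one, mul_one, hDa]
    calc ‖(60 : ℚ_[3])‖ * ‖q‖ * ‖X‖⁻¹ ≤ 3⁻¹ * ‖q‖ * ‖X‖⁻¹ := by gcongr
      _ = ‖X‖⁻¹ * (3⁻¹ * ‖q‖) := by ring
  have hq3 : ‖q‖ ≤ 3⁻¹ := (norm_le_inv_of_norm_lt_one hq).trans (by norm_num)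
  have hq2 : ‖q‖ ^ 2 ≤ 3⁻¹ * ‖q‖ := by rw [sq]; exact mul_le_mul_of_nonneg_right hq3 (norm_nonneg _)
  have hmax : ‖X‖⁻¹ * max ‖X‖⁻¹ (‖q‖ ^ 2) ≤ ‖X‖⁻¹ * max ‖X‖⁻¹ (3⁻¹ * ‖q‖) :=
    mul_le_mul_of_nonneg_left (max_le_max (le_refl _) hq2) (by positivity)
  set E := heightFourOneCoord W 3 q x y - padicLog 3 a - (V.b₂ * V.b₄ - 18 * V.b₆) / V.c₄ * (D / a)
    with hEdef
  have e : E = (E - 60 * (V.c₆ / V.c₄) * q * (D / a)) + 60 * (V.c₆ / V.c₄) * q * (D / a) := by ring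
  rw [e]
  refine (norm_add_le_max _ _).trans (max_le (hB.trans hmax) (hT.trans ?_))
  gcongr; exact le_max_right _ _

/-- **THE DEEP-POINT LAW FOR THE TATE PARAMETER (rational closed form, precision `2k + min(2k, 2ν)`).**
For `W/ℚ` globally minimal with multiplicative reduction at `3`, `q` with `‖q‖₃ < 1` and `tateJ q = j(W)`
(THE Tate parameter of `W` at `3`, `‖q‖₃ = 3^{−v₃Δ}`), and any rational affine point `P = (x, y)` of level
`≥ 2`: `‖ĥ₃(P) − log₃(num x) − [(b₂b₄ − 18b₆)/c₄ + 60(c₆/c₄)/j]·(den x)/(num x)‖₃ ≤ ‖x‖₃⁻¹·max(‖x‖₃⁻¹, ‖q‖₃²)`.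
Since `1/j = Δ/c₄³`, the `3`-adic height of a deep point is the RATIONAL closed form
`log₃ a + [(b₂b₄ − 18b₆)/c₄ + 60c₆Δ/c₄⁴]·D/a` of the minimal model up to `3^{−(2k + min(2k, 2ν))}`: the
Kodaira type `I_ν` fixes the reliable digits. (`‖1/j − q‖ ≤ ‖q‖²`: `j(q) = 1/q + 744 + 196884q + …`.)
[cite: SteinWuthrich2013, §4.1 eq. (4.1), §4.2] [cite: SilvermanATAEC1994, Thm. V.3.1 (b), §V.5] -/
theorem norm_heightFourOneCoord_sub_padicLog_num_sub_le_deep_j [W.IsElliptic] [W.IsGloballyMinimal]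
    (hW : Mult W 3) {q : ℚ_[3]} (hq : ‖q‖ < 1) (hj : tateJ q = (W.j : ℚ_[3])) {x y : ℚ}
    (hxy : W.toAffine.Nonsingular x y) (hx : 1 < ‖(x : ℚ_[3])‖) (hz9 : ‖-(x : ℚ_[3]) / y‖ ≤ 1 / 9) :
    ‖heightFourOneCoord W 3 q x y - padicLog 3 ((x.num : ℚ) : ℚ_[3]) -
        (((W.baseChange ℚ_[3]).b₂ * (W.baseChange ℚ_[3]).b₄ - 18 * (W.baseChange ℚ_[3]).b₆) /
            (W.baseChange ℚ_[3]).c₄ +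
          60 * ((W.baseChange ℚ_[3]).c₆ / (W.baseChange ℚ_[3]).c₄) * ((W.j : ℚ_[3]))⁻¹) *
          (((x.den : ℚ) : ℚ_[3]) / ((x.num : ℚ) : ℚ_[3]))‖
      ≤ ‖(x : ℚ_[3])‖⁻¹ * max ‖(x : ℚ_[3])‖⁻¹ (‖q‖ ^ 2) := by
  set X : ℚ_[3] := (x : ℚ_[3]) with hXdef
  set V := W.baseChange ℚ_[3] with hVdef
  set a : ℚ_[3] := ((x.num : ℚ) : ℚ_[3]) with hadef
  set D : ℚ_[3] := ((x.den : ℚ) : ℚ_[3]) with hDdef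
  have hB := norm_heightFourOneCoord_sub_padicLog_num_sub_sub_le_deep hW hq hxy hx hz9
  have hX0n : 0 < ‖X‖ := one_pos.trans hx
  have hnum : a = X * D := by rw [hadef, hXdef, hDdef, ← Rat.cast_mul, Rat.mul_den_eq_num]
  have hDn : ‖D‖ = ‖X‖⁻¹ := by rw [hDdef]; exact norm_den_eq_inv_norm hx
  have han : ‖a‖ = 1 := by rw [hnum, norm_mul, hDn, mul_inv_cancel₀ hX0n.ne']
  have hDa : ‖D / a‖ = ‖X‖⁻¹ := by rw [norm_div, han, div_one, hDn]
  obtain ⟨hc4, hc6⟩ := norm_c₄_c₆_baseChange_eq_one (W := W) hW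
  have h60 : ‖(60 : ℚ_[3])‖ ≤ 1 := by
    have h : ((60 : ℤ) : ℚ_[3]) = 60 := by norm_cast
    rw [← h]; exact Padic.norm_int_le_one 60
  -- `‖1/j − q‖ ≤ ‖q‖²`
  have hjq : ‖((W.j : ℚ_[3]))⁻¹ - q‖ ≤ ‖q‖ ^ 2 := by
    rw [← hj, sq]; exact norm_inv_tateJ_sub_le hq
  have hT : ‖60 * (V.c₆ / V.c₄) * (((W.j : ℚ_[3]))⁻¹ - q) * (D / a)‖ ≤ ‖X‖⁻¹ * ‖q‖ ^ 2 := by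
    rw [norm_mul, norm_mul, norm_mul, norm_div, hc6, hc4, div_one, mul_one, hDa]
    calc ‖(60 : ℚ_[3])‖ * ‖((W.j : ℚ_[3]))⁻¹ - q‖ * ‖X‖⁻¹ ≤ 1 * ‖q‖ ^ 2 * ‖X‖⁻¹ := by gcongr
      _ = ‖X‖⁻¹ * ‖q‖ ^ 2 := by ring
  have e : heightFourOneCoord W 3 q x y - padicLog 3 a -
      ((V.b₂ * V.b₄ - 18 * V.b₆) / V.c₄ + 60 * (V.c₆ / V.c₄) * ((W.j : ℚ_[3]))⁻¹) * (D / a) =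
      (heightFourOneCoord W 3 q x y - padicLog 3 a - (V.b₂ * V.b₄ - 18 * V.b₆) / V.c₄ * (D / a) -
        60 * (V.c₆ / V.c₄) * q * (D / a)) - 60 * (V.c₆ / V.c₄) * (((W.j : ℚ_[3]))⁻¹ - q) * (D / a) := by
    ring
  rw [e]
  refine (norm_sub_le_max₃ _ _).trans (max_le hB (hT.trans ?_))
  gcongr; exact le_max_right _ _

end Laws

end Summit.BirchSwinnertonDyer.Rank1Residual.X11b.RegMult.HeightLogNumerator

end
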